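import Summits.KontsevichZagierPeriods.KontsevichZagierPeriods.Theses.LinRedNormalForm
import Summits.KontsevichZagierPeriods.KontsevichZagierPeriods.Theorems.DihedralNormalForm.Negative.LoadBearing
import Summits.KontsevichZagierPeriods.KontsevichZagierPeriods.Theorems.LinRedNormalFormResidualBeyondGenusZeroOneRep
import Literature.NumberTheory.Transcendental.KZRelationsLE
import Literature.NumberTheory.Transcendental.KZSubcalculusInvariants
import Literature.NumberTheory.Transcendental.KZLogCalculusProofs

/-!
# `ResidualBeyondGenusZero` (stmt-KontsevichZagierPeriods-3917): negative side, I — load-bearing moves and refuted strengthenings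

Landed copy of §§0, 3–5 of the crux work file `Cruxes/ResidualBeyondGenusZero/Disproof.lean`
(cdisprove seat, generation 1) for the DECLARED RESIDUAL of route `LinRedNormalForm`:
`∀ c, eval c = 0 → ∃ c₀ ∈ closure GZ, c - c₀ ∈ KZ.relations`, `GZ` the classes of the absolutely
convergent genus-zero representations. Nothing here refutes the item — it is summit-strength
(`KontsevichZagierPeriods → ResidualBeyondGenusZero`, file
`LinRedNormalFormResidualBeyondGenusZeroStrength.lean`), so a refutation would refute Conjecture 1
over the fixed calculus. What this file PROVES (0 `sorry`), for other seats to import: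

* §0 `gzSet` (= the inlined generator set, `gzSet_eq`), `residual_iff`, `simplex_nonempty`,
  `exists_rat_value_eq_of_isGenusZero_zero` (dimension-`0` genus-zero values are rational).
* §3 RULE (3) IS LOAD-BEARING: `residual_false_without_newtonLeibniz` — with `relations` replaced
  by the sub-calculus generated by (1a), (1b), (2) the item is false (invariant `evalDim 0`, rational
  on `closure gzSet`; witness `[pt, √2] − [Δ₁, √2]`).
* §4 ADDITIVITY IS LOAD-BEARING: `residual_false_without_additivity` — with `relations` replaced by
  the sub-calculus generated by (2), (3) the item is false (invariant `emptyCount`; witness `[∅]`).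
* §5 REFUTED STRENGTHENINGS: `not_residualOnTheNose` (no moves at all), `not_residualUnique`
  (uniqueness of the normal form; `relations ⊓ closure gzSet ≠ ⊥`).
Companion file `Truncations.lean` (§§2, 6 of the work file): the hypothesis `eval c = 0`, and why
no truncation / torsion variant of the item is weaker than the kernel conjecture.

Sources: M. Kontsevich, D. Zagier, *Periods* (2001), §§1.1–1.2 (the rules; Conjecture 1);
A. Huber, S. Müller-Stach, *Periods and Nori Motives* (2017), Conj. 13.2.1 (kernel form). -/

noncomputable section

open MeasureTheory Set
open Literature.NumberTheory.Transcendental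

namespace Summit.KontsevichZagierPeriods.ResidualBeyondGenusZero.Negative

open Summit.KontsevichZagierPeriods.KontsevichZagierPeriods.Theses.LinRedNormalForm
  (ResidualBeyondGenusZero DihedralNormalForm MzvKernelInKZ closes)
open Summit.KontsevichZagierPeriods.DihedralNormalForm.Negative
  (simplex gzIntegrand IsGenusZero evalDim evalDim_of relationsWithoutNL
    relationsWithoutNL_le_relations relationsWithoutNL_le_ker_evalDim oneRep oneRep_value
    isGenusZero_oneRep)

/-! ## §0 Read-back: the generator set, named -/

/-- The genus-zero generator set of the crux: classes `[r]` of representations on the open ordered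
simplex with a genus-zero integrand (`IsGenusZero`, from the `DihedralNormalForm` negative file). -/
def gzSet : Set KZ.FormalRep :=
  {x | ∃ (k : ℕ) (r : KZ.IntegralRep k), IsGenusZero r ∧ x = KZ.of r}

/-- `gzSet` is, on the nose, the set inlined in the route decl. -/
theorem gzSet_eq : gzSet = {x : KZ.FormalRep | ∃ (k : ℕ) (r : KZ.IntegralRep k)
    (p : MvPolynomial (Fin k) ℚ) (a : Fin k → Fin k → ℕ) (b c : Fin k → ℕ),
    r.domain = {t | (∀ i, 0 < t i) ∧ (∀ i, t i < 1) ∧ StrictAnti t} ∧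
    Set.EqOn r.integrand (fun t => MvPolynomial.aeval t p / ((∏ i, t i ^ b i) *
      (∏ i, (1 - t i) ^ c i) * ∏ i, ∏ j, if i < j then (t i - t j) ^ a i j else 1))
      r.domain ∧ x = KZ.of r} := by
  ext x
  constructor
  · rintro ⟨k, r, ⟨p, a, b, c, hdom, hint⟩, rfl⟩
    exact ⟨k, r, p, a, b, c, hdom, hint, rfl⟩
  · rintro ⟨k, r, p, a, b, c, hdom, hint, rfl⟩
    exact ⟨k, r, ⟨p, a, b, c, hdom, hint⟩, rfl⟩

/-- READ-BACK: the crux says `ker eval ⊆ relations + closure gzSet`, elementwise. -/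
theorem residual_iff : ResidualBeyondGenusZero ↔
    ∀ c : KZ.FormalRep, KZ.eval c = 0 →
      ∃ c₀ ∈ AddSubgroup.closure gzSet, c - c₀ ∈ KZ.relations := by
  rw [gzSet_eq]
  exact Iff.rfl

/-- The open ordered simplex is inhabited in every dimension (point `tᵢ = 1/(i+2)`), so no
genus-zero generator has empty domain. -/
theorem simplex_nonempty (k : ℕ) : (simplex k).Nonempty := by
  refine ⟨fun i => 1 / (((i : ℕ) : ℝ) + 2), fun i => by positivity, fun i => ?_, fun i j hij => ?_⟩
  · rw [div_lt_one (by positivity)]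
    have : (0 : ℝ) ≤ ((i : ℕ) : ℝ) := Nat.cast_nonneg _
    linarith
  · have h : ((i : ℕ) : ℝ) < ((j : ℕ) : ℝ) := by exact_mod_cast hij
    exact one_div_lt_one_div_of_lt (by positivity) (by linarith)

/-- A genus-zero representation of dimension `0` evaluates to a rational number (the constant
coefficient of its numerator: `ℝ⁰` is one point of volume `1`, all products are empty). -/
theorem exists_rat_value_eq_of_isGenusZero_zero {s : KZ.IntegralRep 0} (hs : IsGenusZero s) :
    ∃ q : ℚ, s.value = q := by
  obtain ⟨p, a, b, c, hdom, hint⟩ := hs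
  refine ⟨MvPolynomial.coeff 0 p, ?_⟩
  have volume_univ_fin_zero : volume (univ : Set (Fin 0 → ℝ)) = 1 := by
    rw [volume_pi, Measure.pi_univ]; simp
  have simplex_zero : simplex 0 = univ := by
    ext t
    simp only [simplex, mem_setOf_eq, mem_univ, iff_true]
    exact ⟨fun i => i.elim0, fun i => i.elim0, fun i => i.elim0⟩
  have hp : ∀ t : Fin 0 → ℝ, MvPolynomial.aeval t p = ((MvPolynomial.coeff 0 p : ℚ) : ℝ) := by
    intro t
    conv_lhs => rw [MvPolynomial.eq_C_of_isEmpty p]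
    simp
  have hfun : s.integrand = fun _ => ((MvPolynomial.coeff 0 p : ℚ) : ℝ) := by
    funext t
    have ht : t ∈ s.domain := by rw [hdom, simplex_zero]; trivial
    rw [hint ht]
    simp [gzIntegrand, hp]
  rw [KZ.IntegralRep.value, hdom, simplex_zero, Measure.restrict_univ, hfun, integral_const,
    measureReal_def, volume_univ_fin_zero]
  simp

/-! ## §3 Rule (3) is load-bearing: the residual fails in the sub-calculus (1a)+(1b)+(2)

`evalDim 0` (value of the dimension-`0` part) is an invariant of the additivity and
change-of-variables moves (they act inside one dimension and are sound), and on the genus-zero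
closure it takes RATIONAL values (dimension-`0` genus-zero representations are the rational
constants; higher-dimensional ones do not contribute). The vanishing combination
`c = [pt, √2] − [Δ₁, √2]` (the constant `√2` in dimension `0` minus the constant integrand `√2`
over `(0,1)`) has `evalDim 0 c = √2`: irrational. Hence `c - c₀ ∉ relationsWithoutNL` for every
`c₀ ∈ closure gzSet`: any move chain realising the residual for `c` uses Newton–Leibniz. -/

/-- The crux with `KZ.relations` replaced by the sub-calculus generated by (1a), (1b), (2). -/
def ResidualWithoutNewtonLeibniz : Prop :=
  ∀ c : KZ.FormalRep, KZ.eval c = 0 →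
    ∃ c₀ ∈ AddSubgroup.closure gzSet, c - c₀ ∈ relationsWithoutNL

/-- `evalDim 0` is rational on the genus-zero closure. -/
theorem exists_rat_evalDim_zero_of_mem_closure_gzSet {c₀ : KZ.FormalRep}
    (h : c₀ ∈ AddSubgroup.closure gzSet) : ∃ q : ℚ, evalDim 0 c₀ = q := by
  induction h using AddSubgroup.closure_induction with
  | mem x hx =>
    obtain ⟨k, r, hr, rfl⟩ := hx
    rw [evalDim_of]
    split_ifs with hk
    · subst hk
      exact exists_rat_value_eq_of_isGenusZero_zero hr
    · exact ⟨0, by simp⟩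
  | zero => exact ⟨0, by simp⟩
  | add x y _ _ hx hy =>
    obtain ⟨q, hq⟩ := hx
    obtain ⟨q', hq'⟩ := hy
    exact ⟨q + q', by simp [hq, hq']⟩
  | neg x _ hx =>
    obtain ⟨q, hq⟩ := hx
    exact ⟨-q, by simp [hq]⟩

/-- `√2` is algebraic over `ℚ` (root of `X² − 2`), so `[σ, √2·f]` is again a representation. -/
theorem isAlgebraic_sqrt_two : IsAlgebraic ℚ (Real.sqrt 2) := by
  refine ⟨Polynomial.X ^ 2 - Polynomial.C 2, Polynomial.X_pow_sub_C_ne_zero (by norm_num) 2, ?_⟩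
  have h2 : Real.sqrt 2 ^ 2 = 2 := Real.sq_sqrt (by norm_num)
  simp [h2]

/-- **Rule (3) is load-bearing for the residual.** -/
theorem residual_false_without_newtonLeibniz : ¬ ResidualWithoutNewtonLeibniz := by
  intro h
  obtain ⟨r₁, ⟨hdom, hint⟩, hval⟩ :=
    _root_.Summit.KontsevichZagierPeriods.ResidualBeyondGenusZero.exists_genusZero_value_eq_ratCast 1
  -- the dimension-0 constant √2 and the dimension-1 constant √2 over (0,1)
  set A : KZ.IntegralRep 0 := r₁.constMul (Real.sqrt 2) isAlgebraic_sqrt_two with hA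
  set B : KZ.IntegralRep 1 := oneRep.constMul (Real.sqrt 2) isAlgebraic_sqrt_two with hB
  have hvA : A.value = Real.sqrt 2 := by
    rw [hA, KZ.IntegralRep.value_constMul, hval]; simp
  have hvB : B.value = Real.sqrt 2 := by
    rw [hB, KZ.IntegralRep.value_constMul, oneRep_value, mul_one]
  obtain ⟨c₀, hc₀, hrel⟩ := h (KZ.of A - KZ.of B) (by simp [hvA, hvB])
  have h0 : evalDim 0 (KZ.of A - KZ.of B - c₀) = 0 :=
    (AddMonoidHom.mem_ker).1 (relationsWithoutNL_le_ker_evalDim 0 hrel)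
  obtain ⟨q, hq⟩ := exists_rat_evalDim_zero_of_mem_closure_gzSet hc₀
  rw [map_sub, map_sub, evalDim_of, evalDim_of, hq, hvA] at h0
  simp only [↓reduceIte, Nat.one_ne_zero, sub_zero] at h0
  exact irrational_sqrt_two ⟨q, by linarith⟩

/-! ## §4 Additivity is load-bearing: the residual fails in the sub-calculus (2)+(3)

The invariant: `emptyCount [r] = 1` if `r.domain = ∅`, else `0`. A change of variables has
`r'.domain = Φ '' r.domain`, empty iff `r.domain` is; a Newton–Leibniz move has `r.domain` = the
band over `r'.domain` with `a ≤ b`, empty iff `r'.domain` is. Genus-zero domains are inhabited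
simplices. The vanishing combination `[∅]` (`KZ.IntegralRep.empty 0`) has `emptyCount = 1`, so
`[∅] - c₀` is never in the sub-calculus (2)+(3): disposing of a null representation needs an
additivity move (indeed `[∅] = −([∅] − [∅] − [∅]) ∈ relations` by (1a)). The witness is
degenerate on purpose: for the natural witness `[r] + [r.neg]` (`value r = √2`) every invariant
of (2)+(3) we can evaluate factors through the VALUES of the generators, and excluding a
genus-zero correction then needs "`√2` is not a genus-zero value", an open transcendence
statement (cf. §2). -/

/-- The sub-calculus WITHOUT the additivity moves: generated by (2) and (3) only. -/
def relationsWithoutAdditivity : AddSubgroup KZ.FormalRep :=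
  AddSubgroup.closure (KZ.changeOfVariablesRel ∪ KZ.newtonLeibnizRel)

/-- The sub-calculus (2)+(3) is part of `KZ.relations`. -/
theorem relationsWithoutAdditivity_le_relations : relationsWithoutAdditivity ≤ KZ.relations := by
  refine AddSubgroup.closure_mono ?_
  rintro c (hc | hc)
  · exact Or.inl (Or.inr hc)
  · exact Or.inr hc

open scoped Classical in
/-- The number of generators with EMPTY domain (with multiplicity). -/
def emptyCount : KZ.FormalRep →+ ℤ :=
  FreeAbelianGroup.lift fun p => if p.2.domain = ∅ then 1 else 0

/-- `emptyCount [r] = 1` when the domain of `r` is empty. [folklore] -/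
theorem emptyCount_of_eq {n : ℕ} {r : KZ.IntegralRep n} (h : r.domain = ∅) :
    emptyCount (KZ.of r) = 1 := by
  simp [emptyCount, KZ.of, h]

/-- `emptyCount [r] = 0` when the domain of `r` is inhabited. [folklore] -/
theorem emptyCount_of_ne {n : ℕ} {r : KZ.IntegralRep n} (h : r.domain ≠ ∅) :
    emptyCount (KZ.of r) = 0 := by
  simp [emptyCount, KZ.of, h]

/-- **`emptyCount` is an invariant of the moves (2) and (3).** -/
theorem relationsWithoutAdditivity_le_ker_emptyCount :
    relationsWithoutAdditivity ≤ emptyCount.ker := by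
  refine (AddSubgroup.closure_le _).mpr ?_
  rintro c (hc | hc)
  · obtain ⟨n, r, r', Φ, Φ', -, -, -, hdom, -, rfl⟩ := hc
    rw [SetLike.mem_coe, AddMonoidHom.mem_ker, map_sub, sub_eq_zero]
    by_cases h : r.domain = ∅
    · rw [emptyCount_of_eq h, emptyCount_of_eq (by rw [hdom, h, image_empty])]
    · have h' : r'.domain ≠ ∅ := by
        rw [hdom]
        exact nonempty_iff_ne_empty.1 ((nonempty_iff_ne_empty.2 h).image Φ)
      rw [emptyCount_of_ne h, emptyCount_of_ne h']
  · obtain ⟨n, r, r', a, b, F, -, -, -, hab, hdom, -, -, -, rfl⟩ := hc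
    rw [SetLike.mem_coe, AddMonoidHom.mem_ker, map_sub, sub_eq_zero]
    by_cases h : r'.domain = ∅
    · have h' : r.domain = ∅ := by
        rw [hdom]
        ext z
        simp [h]
      rw [emptyCount_of_eq h', emptyCount_of_eq h]
    · obtain ⟨x, hx⟩ := nonempty_iff_ne_empty.2 h
      have h' : r.domain ≠ ∅ := by
        rw [hdom]
        refine nonempty_iff_ne_empty.1 ⟨Fin.snoc x (a x), ?_⟩
        simp only [mem_setOf_eq, Fin.init_snoc, Fin.snoc_last]
        exact ⟨hx, le_rfl, hab x hx⟩
      rw [emptyCount_of_ne h', emptyCount_of_ne h]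

/-- **`emptyCount` vanishes on the genus-zero closure** (simplices are inhabited). -/
theorem closure_gzSet_le_ker_emptyCount : AddSubgroup.closure gzSet ≤ emptyCount.ker := by
  refine (AddSubgroup.closure_le _).mpr ?_
  rintro x ⟨k, r, ⟨p, a, b, c, hdom, -⟩, rfl⟩
  rw [SetLike.mem_coe, AddMonoidHom.mem_ker, emptyCount_of_ne]
  rw [hdom]
  exact nonempty_iff_ne_empty.1 (simplex_nonempty k)

/-- The crux with `KZ.relations` replaced by the sub-calculus generated by (2), (3). -/
def ResidualWithoutAdditivity : Prop :=
  ∀ c : KZ.FormalRep, KZ.eval c = 0 →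
    ∃ c₀ ∈ AddSubgroup.closure gzSet, c - c₀ ∈ relationsWithoutAdditivity

/-- **Additivity is load-bearing for the residual** (witness `[∅]`). -/
theorem residual_false_without_additivity : ¬ ResidualWithoutAdditivity := by
  intro h
  obtain ⟨c₀, hc₀, hrel⟩ := h (KZ.of (KZ.IntegralRep.empty 0)) (by simp)
  have h1 := (AddMonoidHom.mem_ker).1 (relationsWithoutAdditivity_le_ker_emptyCount hrel)
  rw [map_sub, emptyCount_of_eq (KZ.IntegralRep.domain_empty),
    (AddMonoidHom.mem_ker).1 (closure_gzSet_le_ker_emptyCount hc₀)] at h1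
  norm_num at h1


/-! ## §5 Refuted strengthenings

(a) ON THE NOSE: "every vanishing combination IS a genus-zero combination" (no moves) fails at
`c = [∅]` (`emptyCount`). (b) UNIQUENESS of the normal form fails at `c = 0`: the genus-zero ZERO
representation `[Δ₀, 0]` is a non-zero element of `relations ⊓ closure gzSet` (integrand
additivity `[Δ₀,0] − [Δ₀,0] − [Δ₀,0]`), so both `0` and `[Δ₀,0]` are normal forms of `0`. Normal
forms are classes in `closure gzSet ⧸ (relations ⊓ closure gzSet)`, never elements. -/

/-- Strengthening (a): vanishing combinations are genus-zero combinations on the nose. -/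
def ResidualOnTheNose : Prop :=
  ∀ c : KZ.FormalRep, KZ.eval c = 0 → c ∈ AddSubgroup.closure gzSet

/-- **(a) is false**: `[∅]` vanishes and is no genus-zero combination. -/
theorem not_residualOnTheNose : ¬ ResidualOnTheNose := by
  intro h
  have h1 := (AddMonoidHom.mem_ker).1
    (closure_gzSet_le_ker_emptyCount (h (KZ.of (KZ.IntegralRep.empty 0)) (by simp)))
  rw [emptyCount_of_eq KZ.IntegralRep.domain_empty] at h1
  exact one_ne_zero h1

/-- A genus-zero representation which is itself a relation: `[Δ₀, 0]` (numerator `P = 0`). -/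
theorem exists_isGenusZero_of_mem_relations :
    ∃ r : KZ.IntegralRep 0, IsGenusZero r ∧ KZ.of r ∈ KZ.relations := by
  obtain ⟨r, ⟨hdom, hint⟩, -⟩ :=
    _root_.Summit.KontsevichZagierPeriods.ResidualBeyondGenusZero.exists_genusZero_value_eq_ratCast 0
  refine ⟨r, ⟨MvPolynomial.C 0, 0, 0, 0, hdom, hint⟩, ?_⟩
  refine KZ.of_mem_relations_of_eqOn_zero r fun x hx => ?_
  have := hint hx
  simpa using this

/-- Strengthening (b): the genus-zero normal form is unique. -/
def ResidualUnique : Prop :=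
  ∀ c : KZ.FormalRep, KZ.eval c = 0 →
    ∃! c₀, c₀ ∈ AddSubgroup.closure gzSet ∧ c - c₀ ∈ KZ.relations

/-- **(b) is false** already at `c = 0` (`0` and `[Δ₀, 0]` are both normal forms; they differ
since `coeffSum [Δ₀,0] = 1`). -/
theorem not_residualUnique : ¬ ResidualUnique := by
  intro h
  obtain ⟨r, hr, hrel⟩ := exists_isGenusZero_of_mem_relations
  obtain ⟨c₀, -, huniq⟩ := h 0 (map_zero _)
  have h0 : (0 : KZ.FormalRep) = c₀ := huniq 0 ⟨zero_mem _, by simp⟩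
  have h1 : KZ.of r = c₀ :=
    huniq (KZ.of r) ⟨AddSubgroup.subset_closure ⟨0, r, hr, rfl⟩,
      by simpa using KZ.relations.neg_mem hrel⟩
  have : KZ.coeffSum (KZ.of r) = KZ.coeffSum 0 := by rw [h1, ← h0]
  simp at this

/-- The positive content behind (b): `relations ⊓ closure gzSet ≠ ⊥`. -/
theorem relations_inf_closure_gzSet_ne_bot :
    KZ.relations ⊓ AddSubgroup.closure gzSet ≠ ⊥ := by
  obtain ⟨r, hr, hrel⟩ := exists_isGenusZero_of_mem_relations
  intro h
  have hmem : KZ.of r ∈ KZ.relations ⊓ AddSubgroup.closure gzSet :=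
    ⟨hrel, AddSubgroup.subset_closure ⟨0, r, hr, rfl⟩⟩
  rw [h, AddSubgroup.mem_bot] at hmem
  have : KZ.coeffSum (KZ.of r) = 0 := by rw [hmem, map_zero]
  simp at this

end Summit.KontsevichZagierPeriods.ResidualBeyondGenusZero.Negative
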